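import Summits.BirchSwinnertonDyer.BirchSwinnertonDyer.Theorems.ClassRecordThreeCornerAtThreeShimuraWalkDefs
import Literature.NumberTheory.EllipticCurves.HeegnerPointsKolyvaginPrimaryClassesProofs
import HarnessLib

/-!
# The `hordκ` entry of the Jetchev-walk dictionary for CARRIER-STYLE Kolyvagin classes (generic `A ⊆ E(K̄)`, `Pt ∈ A`), and its reading in the
# currency `ShimuraWalk.mdiv` of the port targets (cell `bsd-stepL`, seat `bsd-stepL-corner3-p2` g7 = WIDTH-LEVER lane B;
# `--supports stmt-BirchSwinnertonDyer-21420 --as helper`)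

WHY (PORT-SPEC §3b, HOME/corner3/g7/CORNER3-G7.md). The family-agnostic per-level engine `Koly.tamagawaExponent_le_m_of_orderedFamiliesBase_of_classes`
(p593074) takes, among its class-level inputs, `hordκ : p^(k−j) ∣ addOrderOf (κ s) → md s ≤ j` (the order of the level-`p^k` class bounds the
divisibility exponent of the derived point — McCallum Cor. 4.5 ∕ Gross Prop. 4.7 (1), «if» direction only). For the X₀(N) datum this is
corner-p1's `hordκ_of_admissibleData_of_irreducible`. THIS FILE proves it for ANY carrier-style class — Kolyvagin's class
`kolyvaginClass E n hdiv hA P hP ∈ H¹(K, E[n])` of a point `P` of a `Γ_K`-admissible subgroup `A ⊆ E(K̄)` (the shape in which shim-p1∕g5's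
carrier `hpointsRk_of_shimuraLabels_of_noTorsion(_pdiv)` delivers the classes of the labelled CM family of `X_{N⁺,N⁻}`):
* `zsmul_kolyvaginClass_eq_zero_of_exists_mem` — `(∃ B ∈ A, (p^(j+1)) • B = P) → p^(k−j−1) • c_{p^k}(P) = 0` (`j < k`), from the tree's
  one-directional `KolyvaginCocycle.cls_eq_zero_of_mem` and `cls_zsmul` (no «fixed points lie in `A`» input needed);
* `not_exists_mem_of_pow_dvd_addOrderOf` — hence `p^(k−j) ∣ addOrderOf c_{p^k}(P)` excludes `∃ B ∈ A, p^(j+1)·B = P`;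
* `ShimuraWalk.mdiv_le_of_pow_dvd_addOrderOf` — with the `PDiv`-bridge clause of the re-issued carrier (`…ShimuraCarrierOfNoTorsionPDiv`,
  «`ShimuraWalk.PDiv hK ι W y p m μ → ∃ B ∈ A m, p^μ·B = Pt m`») taken as a hypothesis: `p^(k−j) ∣ addOrderOf κ → ShimuraWalk.mdiv … ≤ j` —
  VERBATIM the `hordκ` binder of p593074 at `md := ShimuraWalk.mdiv`.
HONEST FRAMING: theorems only (no definition, no named fact, no `sorry`); pure Kummer-theoretic bookkeeping; nothing about any curve; no stub
closes; BSD is not proved by any of this; T7. References: [cite: McCallumLMS1991, §4 (6), Cor. 4.5] [cite: GrossLMS1991, §4 (4.4), Prop. 4.7 (1)].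
-/

set_option autoImplicit false
set_option linter.dupNamespace false

noncomputable section

open scoped Classical

open WeierstrassCurve Literature.NumberTheory.EllipticCurves Literature.NumberTheory.EllipticCurves.KolyvaginCocycle
  Literature.NumberTheory.GaloisRepresentations Literature.NumberTheory.EllipticCurves.RingClassField

namespace Summit.BirchSwinnertonDyer.BirchSwinnertonDyer.Theorems.ShimuraWalk

universe u

section Generic

variable {K : Type u} [Field K] {E : WeierstrassCurve K} {p k : ℕ}
  {hdiv : ∀ P : geomPoints E, ∃ Q : geomPoints E, ((p ^ k : ℕ) : ℤ) • Q = P}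
  {A : AddSubgroup (geomPoints E)}

/-- **McCallum Cor. 4.5 ∕ Gross Prop. 4.7 (1), «if» direction, for a carrier-style class and a multiple**: if `P = p^(j+1)·B` with `B ∈ A`
(`j < k`) then `p^(k−j−1) • c_{p^k}(P) = 0` in `H¹(K, E[p^k])` — since `p^(k−j−1) • c(P) = c(p^(k−j−1)·P)` (`cls_zsmul`) and
`p^(k−j−1)·P = p^k·B ∈ p^k A` (`cls_eq_zero_of_mem`). [cite: McCallumLMS1991, §4 (6), Cor. 4.5] [cite: GrossLMS1991, Prop. 4.7 (1)] -/
theorem zsmul_kolyvaginClass_eq_zero_of_exists_mem (hA : IsAdmissible (Field.absoluteGaloisGroup K) A ((p ^ k : ℕ) : ℤ))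
    {P : geomPoints E} (hP : P ∈ invPoints (Field.absoluteGaloisGroup K) A ((p ^ k : ℕ) : ℤ))
    {j : ℕ} (hj : j < k) (hB : ∃ B ∈ A, ((p ^ (j + 1) : ℕ) : ℤ) • B = P) :
    ((p ^ (k - j - 1) : ℕ) : ℤ) • kolyvaginClass E ((p ^ k : ℕ) : ℤ) hdiv hA P hP = 0 := by
  obtain ⟨B, hBA, hBP⟩ := hB
  obtain ⟨Q₀, hQ₀⟩ := hdiv P
  -- the multiple `p^(k-j-1) • P` and its root `p^(k-j-1) • Q₀`
  have hmP : ((p ^ (k - j - 1) : ℕ) : ℤ) • P ∈ invPoints (Field.absoluteGaloisGroup K) A ((p ^ k : ℕ) : ℤ) :=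
    AddSubgroup.zsmul_mem _ hP _
  have hmQ : ((p ^ k : ℕ) : ℤ) • (((p ^ (k - j - 1) : ℕ) : ℤ) • Q₀) = ((p ^ (k - j - 1) : ℕ) : ℤ) • P := by
    rw [smul_comm, hQ₀]
  rw [kolyvaginClass_eq_cls hA hP hQ₀, ← cls_zsmul hA (continuous_smul_geomPoints E) hP hQ₀ _ hmP hmQ]
  refine cls_eq_zero_of_mem hA _ hmP hmQ ⟨B, hBA, ?_⟩
  have hkj : k - j - 1 + (j + 1) = k := by omega
  rw [← hBP, smul_smul, ← Nat.cast_mul, ← pow_add, hkj]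

/-- **The `hordκ` shape, carrier form**: `p^(k−j) ∣ addOrderOf c_{p^k}(P)` (`j < k`) excludes `P ∈ p^(j+1)·A`.
[cite: McCallumLMS1991, Cor. 4.5] [cite: GrossLMS1991, Prop. 4.7 (1)] -/
theorem not_exists_mem_of_pow_dvd_addOrderOf (hp : p.Prime)
    (hA : IsAdmissible (Field.absoluteGaloisGroup K) A ((p ^ k : ℕ) : ℤ))
    {P : geomPoints E} (hP : P ∈ invPoints (Field.absoluteGaloisGroup K) A ((p ^ k : ℕ) : ℤ))
    {j : ℕ} (hj : j < k) (hdvd : p ^ (k - j) ∣ addOrderOf (kolyvaginClass E ((p ^ k : ℕ) : ℤ) hdiv hA P hP)) :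
    ¬ ∃ B ∈ A, ((p ^ (j + 1) : ℕ) : ℤ) • B = P := by
  intro hB
  have hzero := zsmul_kolyvaginClass_eq_zero_of_exists_mem (hdiv := hdiv) hA hP hj hB
  have hord : addOrderOf (kolyvaginClass E ((p ^ k : ℕ) : ℤ) hdiv hA P hP) ∣ p ^ (k - j - 1) := by
    apply addOrderOf_dvd_of_nsmul_eq_zero
    rw [← natCast_zsmul]
    exact_mod_cast hzero
  have h1 : p ^ (k - j) ∣ p ^ (k - j - 1) := dvd_trans hdvd hord
  have h2 : k - j ≤ k - j - 1 := (Nat.pow_dvd_pow_iff_le_right hp.one_lt).mp h1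
  omega

end Generic

section Shimura

variable {K : Type} [Field K] [NumberField K]

/-- **`hordκ` for the labelled Shimura classes, in the currency of the port targets**: for a carrier package at level `p^k` (admissible
`A`, point `Pt ∈ A` with its class `κ = c_{p^k}(Pt)`) carrying the `PDiv`-bridge clause of `hpointsRk_of_shimuraLabels_of_noTorsion_pdiv` at an
admissible level `m` («`ShimuraWalk.PDiv hK ι W y p m μ → ∃ B ∈ A, p^μ·B = Pt`», hypothesis `hbridge`), `p^(k−j) ∣ addOrderOf κ` (`j < k`)
gives `ShimuraWalk.mdiv hK ι W y p m ≤ j` — VERBATIM the `hordκ` binder of `Koly.tamagawaExponent_le_m_of_orderedFamiliesBase_of_classes` at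
`md := ShimuraWalk.mdiv`. CONDITIONAL on the displayed package; nothing booked. [cite: McCallumLMS1991, Cor. 4.5] [cite: Jetchev2008, §3.1 item 5] -/
theorem mdiv_le_of_pow_dvd_addOrderOf (hK : IsImaginaryQuadratic K) (ι : K →+* ℂ) (W : WeierstrassCurve ℚ)
    (y : (m : ℕ) → (W.baseChange (ringClassField K ι m)).toAffine.Point) {p k : ℕ} (hp : p.Prime)
    {hdiv : ∀ P : geomPoints (W.baseChange K), ∃ Q : geomPoints (W.baseChange K), ((p ^ k : ℕ) : ℤ) • Q = P}
    {A : AddSubgroup (geomPoints (W.baseChange K))}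
    (hA : IsAdmissible (Field.absoluteGaloisGroup K) A ((p ^ k : ℕ) : ℤ))
    {Pt : geomPoints (W.baseChange K)} (hPt : Pt ∈ invPoints (Field.absoluteGaloisGroup K) A ((p ^ k : ℕ) : ℤ))
    {m : ℕ} (hbridge : ∀ μ : ℕ, PDiv hK ι W y p m μ → ∃ B ∈ A, ((p ^ μ : ℕ) : ℤ) • B = Pt)
    {j : ℕ} (hj : j < k)
    (hdvd : p ^ (k - j) ∣ addOrderOf (kolyvaginClass (W.baseChange K) ((p ^ k : ℕ) : ℤ) hdiv hA Pt hPt)) :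
    mdiv hK ι W y p m ≤ (j : ℕ∞) := by
  by_contra hlt
  rw [not_le] at hlt
  have hle : ((j + 1 : ℕ) : ℕ∞) ≤ mdiv hK ι W y p m := Order.add_one_le_of_lt (by exact_mod_cast hlt)
  exact not_exists_mem_of_pow_dvd_addOrderOf (hdiv := hdiv) hp hA hPt hj hdvd
    (hbridge (j + 1) ((natCast_le_mdiv_iff hK ι W y p m (j + 1)).mp hle))

end Shimura

end Summit.BirchSwinnertonDyer.BirchSwinnertonDyer.Theorems.ShimuraWalk

end
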